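import Literature.NumberTheory.Automorphic.UpqTorusAnnihilatorPropagation   -- ★ p834070 (A-p06 (g24)): T2 `upqPFiltration_le_ker_aeval_nodal_torusGen`, `abs_le_of_mem_image_add`
import Literature.NumberTheory.Automorphic.SkewSpectrumFiniteDim           -- ★ p834075 (A-p06 (g24)): T3 `exists_nodal_real_annihilates_of_skew`, real T1
import Literature.NumberTheory.Automorphic.UpqCasimirPPartKStable          -- ★ p831010 (A-p06 (g24)): `upq_apply_mem_of_kStable_of_mem_kInLie`
import Literature.NumberTheory.Automorphic.CasimirBlockTorusWeightBound    -- ★ p830261 (A-p06 (g24)): `torusGen_mem_kInLie`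
import HarnessLib

/-!
# The torus bound on the `𝔭`-filtration: `‖ρ𝔤(t_j) u‖ ≤ (r₀ + n) ‖u‖` on `F n` for every basis torus generator

Topic `NumberTheory/Automorphic`; namespace `Literature.NumberTheory.Automorphic`; THEOREMS ONLY (no `def`, no named fact, no instance declaration, no notation,
no `sorry`).  Cell `hodgecm-mathlib`, F0∕P3, T1a arch line, ROAD-GLOB (A6 #92 at `U(2,1)`), brick «FB», piece **T4c-i** (assembly of T1∕T2∕T3, A-p06 (g24)
plan 2026-08-31).  Data: a `(𝔤, K)`-module `(ρK, ρ𝔤)` of `U(α, β)` (★ `IsGKModule`), a positive definite Hermitian form `B` (★ G0 `IsPosDefHerm`; norms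
`‖emb ·‖`) for which every `ρ𝔤(Y)` is skew, a finite-dimensional `K`-stable `W₀`, and `F n = upqPFiltration ρ𝔤 W₀ n` (★ N1).  THEN there is `r₀ ≥ 0` with
**`‖emb (ρ𝔤(t) u)‖ ≤ (r₀ + n) · ‖emb u‖` for all `n`, all `u ∈ F n`, and every BASIS torus generator `t = torusGen e_j 0` or `torusGen 0 e_l`**
(`norm_emb_torusGen_basis_le`): T3 gives real nodes killing `W₀` (which is `𝔨`-stable, ★ N2), T2 propagates them (shifts `∈ {0, ±1}`), real-T1 bounds the form.
[HarishChandra1953, §9]; [KnappVogan1995, §IV.1, Thm. 0.6].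
HONEST LABEL: closes no registered stub by itself.  HC_CM is proved only modulo the 2 remaining named inputs (hLiu418, h413) until rung 0 closes.

## References
* Harish-Chandra, *Representations of a semisimple Lie group on a Banach space. I*, Trans. AMS 75 (1953), §9 [HarishChandra1953].
* A. W. Knapp, D. A. Vogan, *Cohomological Induction and Unitary Representations* (1995), §IV.1, Thm. 0.6 [KnappVogan1995].
-/

-- Mathlib idiom (as in ★ `GKModules`): the commutator bracket on `Module.End ℂ V`, to MENTION `ρ𝔤 : 𝔤 →ₗ⁅ℝ⁆ End V`.
attribute [local instance 100] LieRing.ofAssociativeRing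

set_option autoImplicit false

noncomputable section

namespace Literature.NumberTheory.Automorphic

open Polynomial Finset
open Literature.RepresentationTheory.KonnoKonno2007 Literature.RepresentationTheory.KonnoKonno2007.RealDualPair
open Literature.RepresentationTheory.BorelWallach2000

variable {α β : Type} [Fintype α] [DecidableEq α] [Fintype β] [DecidableEq β]
variable {V : Type*} [AddCommGroup V] [Module ℂ V]
  (ρK : Representation ℂ (uFormGroup α β).maximalCompact V) (ρ𝔤 : (uFormGroup α β).lie →ₗ⁅ℝ⁆ Module.End ℂ V)

/-! ## §1 One torus generator with admissible shifts -/

/-- **One generator.**  For `t = torusGen a b` whose root shifts are integers of absolute value `≤ 1`, `B` positive definite Hermitian with `ρ𝔤(t)` skew,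
`W₀` finite-dimensional and `ρ𝔤(t)`-stable: there is `r₀ ≥ 0` with `‖emb (ρ𝔤(t) u)‖ ≤ (r₀ + n) ‖emb u‖` for all `u ∈ F n`.
[cite: HarishChandra1953, §9] [cite: KnappVogan1995, §IV.1] -/
theorem exists_norm_emb_torusGen_le (a : α → ℝ) (b : β → ℝ) (hab : ∀ p : α × β, ∃ ε : ℤ, |ε| ≤ 1 ∧ (b p.2 : ℝ) - a p.1 = ε)
    {B : V →ₗ⋆[ℂ] V →ₗ[ℂ] ℂ} (hB : IsPosDefHerm B)
    (hskew : ∀ x y, B (ρ𝔤 ⟨torusGen a b, torusGen_mem_lie a b⟩ x) y = -B x (ρ𝔤 ⟨torusGen a b, torusGen_mem_lie a b⟩ y))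
    (W₀ : Submodule ℂ V) [FiniteDimensional ℂ W₀] (hW₀ : ∀ w ∈ W₀, ρ𝔤 ⟨torusGen a b, torusGen_mem_lie a b⟩ w ∈ W₀) :
    ∃ r₀ : ℝ, 0 ≤ r₀ ∧ ∀ (n : ℕ), ∀ u ∈ upqPFiltration ρ𝔤 W₀ n,
      ‖hB.emb (ρ𝔤 ⟨torusGen a b, torusGen_mem_lie a b⟩ u)‖ ≤ (r₀ + n) * ‖hB.emb u‖ := by
  set D := ρ𝔤 ⟨torusGen a b, torusGen_mem_lie a b⟩ with hD
  -- T3: real nodes killing `W₀`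
  obtain ⟨S₀, r₀, hr₀, hS₀, hkill⟩ := exists_nodal_real_annihilates_of_skew hB D hskew W₀ hW₀
  refine ⟨r₀, hr₀, fun n u hu => ?_⟩
  -- T2: propagation to `F n`
  have hFn := upqPFiltration_le_ker_aeval_nodal_torusGen ρ𝔤 a b hab W₀ S₀ hkill n u hu
  -- real T1 with `r = r₀ + n`
  have hbound := re_form_apply_apply_le_of_skew_of_nodal_real B hB.re_nonneg D hskew _ (r₀ + n)
    (fun y hy => abs_le_of_mem_image_add S₀ r₀ hS₀ n hy) hFn
  -- read through `‖emb ·‖² = Re B · ·`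
  rw [← hB.norm_emb_sq, ← hB.norm_emb_sq, ← mul_pow] at hbound
  have hrn : 0 ≤ (r₀ + n) * ‖hB.emb u‖ := mul_nonneg (by positivity) (norm_nonneg _)
  exact (sq_le_sq₀ (norm_nonneg _) hrn).mp hbound

/-! ## §2 All basis torus generators at once -/

omit [Fintype α] [Fintype β] [DecidableEq β] in
/-- The shifts of `torusGen e_j 0` are `−δ_{j p}` ∈ {0, −1}. [cite: KnappVogan1995, §IV.1] -/
theorem shifts_single_left (j : α) : ∀ p : α × β, ∃ ε : ℤ, |ε| ≤ 1 ∧ ((0 : β → ℝ) p.2 : ℝ) - (Pi.single j (1 : ℝ) : α → ℝ) p.1 = ε := by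
  intro p
  by_cases h : p.1 = j
  · refine ⟨-1, by simp, ?_⟩
    rw [h]; simp
  · refine ⟨0, by simp, ?_⟩
    simp [h]

omit [Fintype α] [DecidableEq α] [Fintype β] in
/-- The shifts of `torusGen 0 e_l` are `δ_{l q}` ∈ {0, 1}. [cite: KnappVogan1995, §IV.1] -/
theorem shifts_single_right (l : β) : ∀ p : α × β, ∃ ε : ℤ, |ε| ≤ 1 ∧ ((Pi.single l (1 : ℝ) : β → ℝ) p.2 : ℝ) - (0 : α → ℝ) p.1 = ε := by
  intro p
  by_cases h : p.2 = l
  · refine ⟨1, by simp, ?_⟩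
    rw [h]; simp
  · refine ⟨0, by simp, ?_⟩
    simp [h]

/-- **T4c-i — THE TORUS BOUND ON THE `𝔭`-FILTRATION.**  `(ρK, ρ𝔤)` a `(𝔤, K)`-module of `U(α, β)`, `B` positive definite Hermitian with every `ρ𝔤(Y)` skew,
`W₀` finite-dimensional and `K`-stable: there is ONE `r₀ ≥ 0` with `‖emb (ρ𝔤(t) u)‖ ≤ (r₀ + n) ‖emb u‖` on `F n = upqPFiltration ρ𝔤 W₀ n` for all `n` and all basis torus
generators `t ∈ {torusGen e_j 0, torusGen 0 e_l}` — the hypotheses `hα`, `hβ` of ★ T4b-ii `norm_emb_ρ𝔤_le_of_mem_kInLie` with `R = r₀ + n`.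
[cite: HarishChandra1953, §9] [cite: KnappVogan1995, Thm. 0.6] -/
theorem exists_norm_emb_torusGen_basis_le (hV : IsGKModule (uFormGroup α β) ρK ρ𝔤) {B : V →ₗ⋆[ℂ] V →ₗ[ℂ] ℂ} (hB : IsPosDefHerm B)
    (hskew : ∀ (Y : (uFormGroup α β).lie) (x y : V), B (ρ𝔤 Y x) y = -B x (ρ𝔤 Y y))
    (W₀ : Submodule ℂ V) [FiniteDimensional ℂ W₀] (hW₀ : ∀ (k : (uFormGroup α β).maximalCompact), ∀ w ∈ W₀, ρK k w ∈ W₀) :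
    ∃ r₀ : ℝ, 0 ≤ r₀ ∧ ∀ (n : ℕ),
      (∀ (j : α), ∀ u ∈ upqPFiltration ρ𝔤 W₀ n,
        ‖hB.emb (ρ𝔤 ⟨torusGen (Pi.single j 1) 0, torusGen_mem_lie _ _⟩ u)‖ ≤ (r₀ + n) * ‖hB.emb u‖) ∧
      (∀ (l : β), ∀ u ∈ upqPFiltration ρ𝔤 W₀ n,
        ‖hB.emb (ρ𝔤 ⟨torusGen 0 (Pi.single l 1), torusGen_mem_lie _ _⟩ u)‖ ≤ (r₀ + n) * ‖hB.emb u‖) := by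
  -- `W₀` is `𝔨`-stable, in particular stable under every torus generator
  have hW₀t : ∀ (a : α → ℝ) (b : β → ℝ), ∀ w ∈ W₀, ρ𝔤 ⟨torusGen a b, torusGen_mem_lie a b⟩ w ∈ W₀ := fun a b w hw =>
    upq_apply_mem_of_kStable_of_mem_kInLie ρK ρ𝔤 hV hW₀ _ (torusGen_mem_kInLie a b) hw
  -- one `r₀` per generator
  have hgenα : ∀ j : α, ∃ r₀ : ℝ, 0 ≤ r₀ ∧ ∀ (n : ℕ), ∀ u ∈ upqPFiltration ρ𝔤 W₀ n,
      ‖hB.emb (ρ𝔤 ⟨torusGen (Pi.single j 1) 0, torusGen_mem_lie _ _⟩ u)‖ ≤ (r₀ + n) * ‖hB.emb u‖ := fun j =>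
    exists_norm_emb_torusGen_le ρ𝔤 _ _ (shifts_single_left j) hB (hskew _) W₀ (hW₀t _ _)
  have hgenβ : ∀ l : β, ∃ r₀ : ℝ, 0 ≤ r₀ ∧ ∀ (n : ℕ), ∀ u ∈ upqPFiltration ρ𝔤 W₀ n,
      ‖hB.emb (ρ𝔤 ⟨torusGen 0 (Pi.single l 1), torusGen_mem_lie _ _⟩ u)‖ ≤ (r₀ + n) * ‖hB.emb u‖ := fun l =>
    exists_norm_emb_torusGen_le ρ𝔤 _ _ (shifts_single_right l) hB (hskew _) W₀ (hW₀t _ _)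
  choose rα hrα0 hrα using hgenα
  choose rβ hrβ0 hrβ using hgenβ
  -- the common `r₀ := Σ_j rα j + Σ_l rβ l`
  refine ⟨∑ j, rα j + ∑ l, rβ l, add_nonneg (Finset.sum_nonneg fun j _ => hrα0 j) (Finset.sum_nonneg fun l _ => hrβ0 l), fun n => ⟨?_, ?_⟩⟩
  · intro j u hu
    have hj : rα j ≤ ∑ j, rα j + ∑ l, rβ l :=
      (Finset.single_le_sum (f := rα) (fun j _ => hrα0 j) (Finset.mem_univ j)).trans (le_add_of_nonneg_right (Finset.sum_nonneg fun l _ => hrβ0 l))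
    exact (hrα j n u hu).trans (mul_le_mul_of_nonneg_right (by linarith) (norm_nonneg _))
  · intro l u hu
    have hl : rβ l ≤ ∑ j, rα j + ∑ l, rβ l :=
      (Finset.single_le_sum (f := rβ) (fun l _ => hrβ0 l) (Finset.mem_univ l)).trans (le_add_of_nonneg_left (Finset.sum_nonneg fun j _ => hrα0 j))
    exact (hrβ l n u hu).trans (mul_le_mul_of_nonneg_right (by linarith) (norm_nonneg _))

end Literature.NumberTheory.Automorphic

end
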